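import Literature.Topology.FourManifolds.HCobordismLevelParity
import Literature.Topology.FourManifolds.LevelCutCohomology
import Literature.Topology.FourManifolds.CobordismEndOrientations
import Literature.Topology.FourManifolds.HCobordismMiddleLevelChain
import Literature.Topology.FourManifolds.RegularSlabCobordism
import Literature.Topology.FourManifolds.HCobordismWallDuality
import Literature.AlgebraicTopology.SingularHomology.OrientationCover
import Literature.AlgebraicTopology.SingularHomology.PoincareDualityProofs
import Literature.AlgebraicTopology.SingularHomology.SimplyConnectedH1
import Literature.AlgebraicTopology.SingularHomology.CohomologyHomotopyInvariance
import HarnessLib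

/-!
# Regular levels of an h-cobordism between even simply connected closed 4-manifolds are even
# (Kirby 1989, Ch. X p. 55, "because `W` is spin", proved homologically)

Topic `Literature/Topology/FourManifolds` (barrier seat
`provefact-Literature.Barriers.SmoothPoincare4.Stab-ad8c696e34`; step C of the level-parity
programme of `HCobordismLevelParity.lean`).  Kirby, *The Topology of 4-Manifolds*, LNM 1374
(1989), Ch. X, proof of Thm. 1, p. 55: *"The framing is zero in `π₁(SO(3)) = ℤ/2` because `W` is
spin"*; Wall 1964, proof of Thm. 3; Gompf–Stipsicz 1999, proof of Thm. 9.2.13 (*"if `M₀` is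
spin, `W` is spin and so `M_{1/2}` is spin, so no `S² ×~ S²` factors appear"*).  For a simply
connected closed 4-manifold, "spin" is "even intersection form", and evenness propagates from the
ends of an h-cobordism to every regular level by homology alone:

* `Cobordism.IsHCobordism.isZero_singularCohomology_three` — `H³(W; ℤ) = 0` for an h-cobordism
  `W` from a simply connected closed 4-manifold (`W ≃ X₁`, Poincaré duality
  `H³(X₁) ≅ H₁(X₁) = 0`; the tree's `poincare_duality`,
  `isZero_singularHomology_one_of_simplyConnectedSpace`, `isoOfHomotopyEquiv'`);
* `isEven_intersectionForm_iff_of_homeomorph` — evenness of the form is a homeomorphism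
  invariant and independent of the orientation (for connected manifolds);
* **`Cobordism.IsHCobordism.isEven_intersectionForm_level`** — for an h-cobordism `c` between
  simply connected closed smooth 4-manifolds `X₁`, `X₂` with EVEN intersection forms, a Morse
  function `g` on `c` all of whose critical points have index `≥ 2`, those below the non-critical
  level `b ∈ (0, 1)` having index `2`, the regular level `g⁻¹(b)` (with its manifold structure
  `RegularLevel`) has even intersection form for every orientation; and
  `…_isEven_intersectionForm_level_of_presentation` — the same for any closed manifold `V`
  smoothly embedded onto the level.

  Proof: cut `W` at the level into the slab cobordisms `g⁻¹[a₀, b]`, `g⁻¹[b, a₁]`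
  (`RegularSlabCobordism.lean`), `a₀` below and `a₁` above all critical values, so that their
  far ends are `X₁`, `X₂` (`nonempty_diffeomorph_level_of_forall_le`); both slabs are simply
  connected (Milnor's Remark 1 after Thm. 6.4 and 3.14, the tree's
  `Cobordism.Milnor1965_simplyConnected_levels_holds`), hence `ℤ`-oriented
  (`Cobordism.exists_isRelFundamentalClass_of_simplyConnectedSpace`) compatibly with orientations
  of their ends (`Cobordism.exists_orientations_δ_eq`); every class on the level is a sum of
  restrictions from the two slabs (`Cobordism.IsMorseFunction.exists_level_eq_map_add_map`,
  Mayer–Vietoris with `H³(W) = 0`); and the lattice core `isEven_intersectionForm_of_cobordisms`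
  (Thom's isotropy on both slabs) concludes.

Consequence (with the oddness of the twisted surgery `V # S² ×~ S²`, not in the tree): the
twisted alternative of `Cobordism.IsHCobordism.isConnectedSum_levels_or_twist` does not occur for
even ends, i.e. the hypothesis `hstep` of `exists_middleLevel_isStabilization_of_isHCobordism_of_step`
for even `X₁` — in particular for the h-cobordisms between homotopy 4-spheres behind
`StableBarrierFour`.  Everything here is proved; no named fact is introduced.

## References

* R. C. Kirby, *The Topology of 4-Manifolds*, LNM 1374 (1989), Ch. X, proof of Thm. 1, p. 55.
  [Kirby1989]
* C. T. C. Wall, *On simply-connected 4-manifolds*, J. London Math. Soc. 39 (1964), proof of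
  Thm. 3 (p. 146). [WallJLMS1964]
* R. E. Gompf, A. I. Stipsicz, *4-Manifolds and Kirby Calculus*, GSM 20 (1999), Thm. 9.2.13.
  [GompfStipsiczGSM1999]
* J. Milnor, *Lectures on the h-cobordism theorem* (1965), Lemma 2.9, Thm. 3.4, 3.14, Remark 1
  after Thm. 6.4 (PDF pp. 11–13, 19–21, 38). [MilnorHCobordism1965]
* R. Thom, *Espaces fibrés en sphères et carrés de Steenrod*, Ann. Sci. ENS 69 (1952), Thm. V.7.
  [Thom1952]
-/

open scoped Manifold ContDiff Topology
open Set Function CategoryTheory Limits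
open Literature.AlgebraicTopology.SingularHomology

noncomputable section

namespace Literature.Topology.FourManifolds

/-! ### Evenness is a homeomorphism invariant -/

section Transport

variable {V V' : Type} [TopologicalSpace V] [T2Space V] [CompactSpace V]
  [ChartedSpace (EuclideanSpace ℝ (Fin 4)) V] [ConnectedSpace V]
  [TopologicalSpace V'] [T2Space V'] [CompactSpace V'] [ChartedSpace (EuclideanSpace ℝ (Fin 4)) V']

/-- **Evenness of the intersection form is a homeomorphism invariant, independent of the
orientation** (connected manifolds): if every orientation of `V'` has even form then so does
every orientation of `V ≃ₜ V'` (`even_intersectionForm_map_iff` and surjectivity of `e^*` on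
cohomology modulo torsion). [cite: MilnorHusemoller1973, §V.1] -/
theorem isEven_intersectionForm_of_homeomorph (e : V ≃ₜ V')
    (h : ∀ ν' : HomologicalOrientation ℤ V' 4, (intersectionForm two_add_two_eq_four ν').IsEven)
    (ν : HomologicalOrientation ℤ V 4) : (intersectionForm two_add_two_eq_four ν).IsEven := by
  let ν' : HomologicalOrientation ℤ V' 4 := ν.comap e.symm
  intro x
  obtain ⟨y, rfl⟩ : ∃ y, freeCohomology.mapEquiv (R := ℤ) e 2 y = x := (freeCohomology.mapEquiv e 2).surjective x
  induction y using freeCohomology.induction_on with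
  | h y =>
    rw [freeCohomology.mapEquiv_apply, freeCohomology.map_mk, even_intersectionForm_map_iff e ν ν' y]
    exact h ν' _

end Transport

/-! ### `H³(W; ℤ) = 0` for an h-cobordism from a simply connected closed 4-manifold -/

section HThree

variable {X₁ X₂ : Type} [TopologicalSpace X₁] [T2Space X₁] [CompactSpace X₁]
  [ChartedSpace (EuclideanSpace ℝ (Fin 4)) X₁] [SimplyConnectedSpace X₁]
  [TopologicalSpace X₂] [ChartedSpace (EuclideanSpace ℝ (Fin 4)) X₂]

/-- **`H³(X; ℤ) = 0` for a simply connected closed 4-manifold** (Poincaré duality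
`H³(X; ℤ) ≅ H₁(X; ℤ)`, Hatcher Thm. 3.30, the tree's `poincare_duality`, and `H₁ = 0` for simply
connected spaces, Hatcher Thm. 2A.1, the tree's `isZero_singularHomology_one_of_simplyConnectedSpace`;
the `ℤ`-orientation exists by Hatcher Prop. 3.25, `isOrientableOver_int_of_simplyConnectedSpace_holds`).
[cite: HatcherAT2002, Thm. 3.30 with Thm. 2A.1] -/
theorem isZero_singularCohomology_three_of_simplyConnectedSpace :
    IsZero (singularCohomology ℤ ℤ X₁ 3) := by
  obtain ⟨μ⟩ := isOrientableOver_int_of_simplyConnectedSpace_holds X₁ (n := 4)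
  have hD := poincare_duality μ (p := 3) (q := 1) (by norm_num)
  have hZ : IsZero (singularHomology ℤ ℤ X₁ 1) :=
    isZero_singularHomology_one_of_simplyConnectedSpace ℤ ℤ (X := X₁)
  have hsub : Subsingleton ↥(singularCohomology ℤ ℤ X₁ 3) := ⟨fun a b => hD.1 (by
    rw [eq_zero_of_isZero ℤ hZ (poincareDualityMap μ (by norm_num : 3 + 1 = 4) a),
      eq_zero_of_isZero ℤ hZ (poincareDualityMap μ (by norm_num : 3 + 1 = 4) b)])⟩
  exact ModuleCat.isZero_of_subsingleton _

/-- **`H³(W; ℤ) = 0` for an h-cobordism `W` from a simply connected closed 4-manifold `X₁`**: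
`X₁ → W` is a homotopy equivalence, so `H³(W; ℤ) ≅ H³(X₁; ℤ) = 0` (homotopy invariance of
cohomology, the tree's `singularCohomology.isoOfHomotopyEquiv'`). [cite: HatcherAT2002, Thm. 3.30 with Cor. 2.11] -/
theorem Cobordism.IsHCobordism.isZero_singularCohomology_three {c : Cobordism 4 X₁ X₂}
    (hc : c.IsHCobordism) : IsZero (singularCohomology ℤ ℤ c.W 3) := by
  obtain ⟨e, -⟩ := hc.1
  exact IsZero.of_iso isZero_singularCohomology_three_of_simplyConnectedSpace
    (singularCohomology.isoOfHomotopyEquiv' ℤ ℤ e 3)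

end HThree

/-! ### The level parity theorem -/

section Level

variable {X₁ X₂ : Type} [TopologicalSpace X₁] [T2Space X₁] [SecondCountableTopology X₁]
  [ChartedSpace (EuclideanSpace ℝ (Fin 4)) X₁] [IsManifold (𝓡 4) ∞ X₁] [CompactSpace X₁] [SimplyConnectedSpace X₁]
  [TopologicalSpace X₂] [T2Space X₂] [SecondCountableTopology X₂]
  [ChartedSpace (EuclideanSpace ℝ (Fin 4)) X₂] [IsManifold (𝓡 4) ∞ X₂] [CompactSpace X₂] [SimplyConnectedSpace X₂]

/-- **Regular levels of an h-cobordism between even simply connected closed 4-manifolds are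
even** (Kirby 1989, Ch. X p. 55, "`W` is spin"; Wall 1964, proof of Thm. 3; Gompf–Stipsicz
Thm. 9.2.13), for the level with its regular-level manifold structure.  Let `c` be an
h-cobordism between simply connected closed smooth 4-manifolds `X₁`, `X₂` whose intersection
forms are even for every orientation, `g` a Morse function on `c` all of whose critical points
have index `≥ 2`, and `b ∈ (0, 1)` a non-critical value below which all critical points have
index `2`.  Then the intersection form of the level `g⁻¹(b)` is even, for every orientation.
See the module docstring for the proof. [cite: Kirby1989, Ch. X, proof of Thm. 1, p. 55] [cite: WallJLMS1964, proof of Thm. 3 (p. 146)] [cite: Thom1952, Thm. V.7 (p. 173)] -/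
theorem Cobordism.IsHCobordism.isEven_intersectionForm_level {c : Cobordism 4 X₁ X₂}
    (hc : c.IsHCobordism) {g : c.W → ℝ} (hg : c.IsMorseFunction g)
    (h2 : ∀ z ∈ criticalSet (𝓡∂ (4 + 1)) g, 2 ≤ morseIndex (𝓡∂ (4 + 1)) g z)
    {b : ℝ} (hb0 : 0 < b) (hb1 : b < 1) (hreg : ∀ z ∈ criticalSet (𝓡∂ (4 + 1)) g, g z ≠ b)
    (hidx : ∀ z ∈ criticalSet (𝓡∂ (4 + 1)) g, g z < b → morseIndex (𝓡∂ (4 + 1)) g z = 2)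
    (hX₁ : ∀ μ : HomologicalOrientation ℤ X₁ 4, (intersectionForm two_add_two_eq_four μ).IsEven)
    (hX₂ : ∀ μ : HomologicalOrientation ℤ X₂ 4, (intersectionForm two_add_two_eq_four μ).IsEven)
    (hb : IsRegularLevel (𝓡∂ (4 + 1)) g b) (ν : HomologicalOrientation ℤ (RegularLevel hb) 4) :
    (intersectionForm two_add_two_eq_four ν).IsEven := by
  have hreg' : ∀ z, IsMCriticalPt (𝓡∂ (4 + 1)) g z → g z ≠ b := fun z hz => hreg z hz
  -- `W` is simply connected
  obtain ⟨eW, -⟩ := hc.1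
  haveI hW : SimplyConnectedSpace c.W := eW.symm.simplyConnectedSpace
  -- levels `a₀` below and `a₁` above all critical values
  obtain ⟨β, hβ, hβf⟩ := hg.exists_pos_forall_isMCriticalPt
  set a₀ : ℝ := min β (b / 2) with ha₀def
  set a₁ : ℝ := max (1 - β) ((b + 1) / 2) with ha₁def
  have ha₀pos : 0 < a₀ := lt_min hβ (by linarith)
  have ha₀b : a₀ < b := (min_le_right _ _).trans_lt (by linarith)
  have ha₀1 : a₀ < 1 := ha₀b.trans hb1
  have hba₁ : b < a₁ := lt_of_lt_of_le (by linarith) (le_max_right _ _)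
  have ha₁1 : a₁ < 1 := max_lt (by linarith) (by linarith)
  have ha₁pos : 0 < a₁ := hb0.trans hba₁
  have hcrit₀ : ∀ z ∈ criticalSet (𝓡∂ (4 + 1)) g, a₀ < g z := fun z hz => by
    have h := (hβf z hz).1
    exact (min_le_left _ _).trans_lt (by linarith)
  have hcrit₁ : ∀ z ∈ criticalSet (𝓡∂ (4 + 1)) g, g z < a₁ := fun z hz => by
    have h := (hβf z hz).2
    exact lt_of_lt_of_le (by linarith) (le_max_left _ _)
  have hrega₀ : ∀ z ∈ criticalSet (𝓡∂ (4 + 1)) g, g z ≠ a₀ := fun z hz h => (hcrit₀ z hz).ne' h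
  have hrega₁ : ∀ z ∈ criticalSet (𝓡∂ (4 + 1)) g, g z ≠ a₁ := fun z hz h => (hcrit₁ z hz).ne h
  -- the two slab cobordisms
  have h₁ : c.IsRegularSlab g a₀ b := ⟨hg, ha₀pos, ha₀b, hb1, hrega₀, hreg⟩
  have h₂ : c.IsRegularSlab g b a₁ := ⟨hg, hb0, hba₁, ha₁1, hreg, hrega₁⟩
  -- simple connectivity of the levels and of the slabs (Milnor, Remark 1 after 6.4 and 3.14)
  have hleva₀ : SimplyConnectedSpace ↥(g ⁻¹' {a₀}) :=
    (Cobordism.Milnor1965_simplyConnected_levels_holds hc hW hg ⟨ha₀pos, ha₀1⟩ hrega₀).1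
      fun z hz hlt => ⟨h2 z hz, by have := hidx z hz (hlt.trans ha₀b); omega⟩
  have hlevb : SimplyConnectedSpace ↥(g ⁻¹' {b}) :=
    (Cobordism.Milnor1965_simplyConnected_levels_holds hc hW hg ⟨hb0, hb1⟩ hreg).1
      fun z hz hlt => ⟨h2 z hz, by have := hidx z hz hlt; omega⟩
  have hslab₁ : SimplyConnectedSpace ↥(g ⁻¹' Icc a₀ b) :=
    (Cobordism.Milnor1965_simplyConnected_levels_holds hc hW hg ⟨ha₀pos, ha₀1⟩ hrega₀).2.2
      ha₀b hb1 hreg hleva₀ fun z hz _ => h2 z hz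
  have hslab₂ : SimplyConnectedSpace ↥(g ⁻¹' Icc b a₁) :=
    (Cobordism.Milnor1965_simplyConnected_levels_holds hc hW hg ⟨hb0, hb1⟩ hreg).2.2
      hba₁ ha₁1 hrega₁ hlevb fun z hz _ => h2 z hz
  haveI : SimplyConnectedSpace (RegularSlab.cobordism h₁).W := hslab₁
  haveI : SimplyConnectedSpace (RegularSlab.cobordism h₂).W := hslab₂
  haveI : SimplyConnectedSpace (RegularLevel hb) := hlevb
  -- the far ends are `X₁`, `X₂`
  have ha₀ : IsRegularLevel (𝓡∂ (4 + 1)) g a₀ := RegularSlab.isRegularLevel_left h₁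
  have ha₁ : IsRegularLevel (𝓡∂ (4 + 1)) g a₁ := RegularSlab.isRegularLevel_right h₂
  obtain ⟨φ₁⟩ := hg.nonempty_diffeomorph_level_of_forall_le ha₀pos ha₀1 hcrit₀ (RegularLevel ha₀)
    (RegularLevel.incl ha₀) (RegularLevel.isSmoothEmbedding_incl ha₀) (RegularLevel.range_incl ha₀)
  have hcs : criticalSet (𝓡∂ (4 + 1)) (fun z => 1 - g z) = criticalSet (𝓡∂ (4 + 1)) g := by
    ext z
    simp only [mem_criticalSet]
    exact isMCriticalPt_const_sub_iff 1 (hg.isMorse.contMDiff.mdifferentiableAt (by simp))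
  have hset : g ⁻¹' {a₁} = (fun z => 1 - g z) ⁻¹' {1 - a₁} := by
    ext z
    simp only [mem_preimage, mem_singleton_iff]
    constructor
    · intro h; rw [h]
    · intro h; linarith
  obtain ⟨φ₂⟩ := hg.symm.nonempty_diffeomorph_level_of_forall_le (b := 1 - a₁) (by linarith)
    (by linarith) (fun z hz => by
      have hz' : z ∈ criticalSet (𝓡∂ (4 + 1)) g := (Set.ext_iff.1 hcs z).1 hz
      linarith [hcrit₁ z hz']) (RegularLevel ha₁)
    (RegularLevel.incl ha₁) (RegularLevel.isSmoothEmbedding_incl ha₁)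
    ((RegularLevel.range_incl ha₁).trans hset)
  -- the level `b` and the ends of the slabs, identified
  let e₁ : RegularLevel hb ≃ₜ RegularSlab.topEnd h₁ := (RegularSlab.topEndDiffeomorph h₁).toHomeomorph
  let e₂ : RegularLevel hb ≃ₜ RegularSlab.botEnd h₂ := (RegularSlab.botEndDiffeomorph h₂).toHomeomorph
  let f₁ : RegularSlab.botEnd h₁ ≃ₜ X₁ :=
    (RegularSlab.botEndDiffeomorph h₁).toHomeomorph.symm.trans φ₁.toHomeomorph.symm
  let f₂ : RegularSlab.topEnd h₂ ≃ₜ X₂ :=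
    (RegularSlab.topEndDiffeomorph h₂).toHomeomorph.symm.trans φ₂.toHomeomorph.symm
  -- instances on the level and on the ends
  haveI : ConnectedSpace (RegularLevel hb) := inferInstance
  haveI : ConnectedSpace (RegularSlab.topEnd h₁) := e₁.surjective.connectedSpace e₁.continuous
  haveI : ConnectedSpace (RegularSlab.botEnd h₂) := e₂.surjective.connectedSpace e₂.continuous
  haveI : ConnectedSpace (RegularSlab.botEnd h₁) := f₁.symm.surjective.connectedSpace f₁.symm.continuous
  haveI : ConnectedSpace (RegularSlab.topEnd h₂) := f₂.symm.surjective.connectedSpace f₂.symm.continuous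
  -- orientations of the ends
  obtain ⟨μX₁⟩ := isOrientableOver_int_of_simplyConnectedSpace_holds X₁ (n := 4)
  obtain ⟨μX₂⟩ := isOrientableOver_int_of_simplyConnectedSpace_holds X₂ (n := 4)
  -- relative fundamental classes of the slabs and the induced end orientations
  obtain ⟨z₁, hz₁⟩ := (RegularSlab.cobordism h₁).exists_isRelFundamentalClass_of_simplyConnectedSpace
  obtain ⟨z₂, hz₂⟩ := (RegularSlab.cobordism h₂).exists_isRelFundamentalClass_of_simplyConnectedSpace
  obtain ⟨μ, ν₁, -, -, hw₁⟩ := (RegularSlab.cobordism h₁).exists_orientations_δ_eq four_ne_zero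
    (μX₁.comap f₁) (ν.comap e₁.symm) hz₁
  obtain ⟨ν₂, π, -, -, hw₂⟩ := (RegularSlab.cobordism h₂).exists_orientations_δ_eq four_ne_zero
    (ν.comap e₂.symm) (μX₂.comap f₂) hz₂
  -- parity of the far ends
  have hM : (intersectionForm two_add_two_eq_four μ).IsEven := isEven_intersectionForm_of_homeomorph f₁ hX₁ μ
  have hP : (intersectionForm two_add_two_eq_four π).IsEven := isEven_intersectionForm_of_homeomorph f₂ hX₂ π
  -- the lattice core, fed by Mayer–Vietoris
  refine isEven_intersectionForm_of_cobordisms (RegularSlab.cobordism h₁) (RegularSlab.cobordism h₂)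
    e₁ e₂ μ ν₁ ν₂ π z₁ hw₁ z₂ hw₂ hM hP ν fun x => ?_
  induction x using freeCohomology.induction_on with
  | h x =>
    obtain ⟨y₁, y₂, hx⟩ := hg.exists_level_eq_map_add_map ℤ hb0 hb1 hreg ha₀b.le hba₁.le
      hc.isZero_singularCohomology_three x
    refine ⟨y₁, y₂, ?_⟩
    -- `inr ∘ e₁` and `inl ∘ e₂` are the inclusions of the level in the two slabs (definitionally)
    subst hx
    exact (map_add (freeCohomology.mk (R := ℤ)) _ _).symm

/-- **Regular levels of an h-cobordism between even simply connected closed 4-manifolds are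
even — for any presentation of the level** (the form in which
`Cobordism.IsHCobordism.isConnectedSum_levels_or_twist` presents levels): with the hypotheses of
`Cobordism.IsHCobordism.isEven_intersectionForm_level`, every compact Hausdorff `V` embedded onto
the level `g⁻¹(b)` has even intersection form for every orientation (evenness is a homeomorphism
invariant, `isEven_intersectionForm_of_homeomorph`). [cite: Kirby1989, Ch. X, proof of Thm. 1, p. 55] [cite: WallJLMS1964, proof of Thm. 3 (p. 146)] -/
theorem Cobordism.IsHCobordism.isEven_intersectionForm_level_of_presentation {c : Cobordism 4 X₁ X₂}
    (hc : c.IsHCobordism) {g : c.W → ℝ} (hg : c.IsMorseFunction g)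
    (h2 : ∀ z ∈ criticalSet (𝓡∂ (4 + 1)) g, 2 ≤ morseIndex (𝓡∂ (4 + 1)) g z)
    {b : ℝ} (hb0 : 0 < b) (hb1 : b < 1) (hreg : ∀ z ∈ criticalSet (𝓡∂ (4 + 1)) g, g z ≠ b)
    (hidx : ∀ z ∈ criticalSet (𝓡∂ (4 + 1)) g, g z < b → morseIndex (𝓡∂ (4 + 1)) g z = 2)
    (hX₁ : ∀ μ : HomologicalOrientation ℤ X₁ 4, (intersectionForm two_add_two_eq_four μ).IsEven)
    (hX₂ : ∀ μ : HomologicalOrientation ℤ X₂ 4, (intersectionForm two_add_two_eq_four μ).IsEven)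
    (V : Type) [TopologicalSpace V] [T2Space V] [CompactSpace V] [ChartedSpace (EuclideanSpace ℝ (Fin 4)) V]
    (ι : V → c.W) (hι : Topology.IsEmbedding ι) (hιr : range ι = g ⁻¹' {b})
    (ν : HomologicalOrientation ℤ V 4) : (intersectionForm two_add_two_eq_four ν).IsEven := by
  have hb : IsRegularLevel (𝓡∂ (4 + 1)) g b := hg.isRegularLevel ⟨hb0, hb1⟩ fun z hz => hreg z hz
  -- the level is connected (simply connected: Milnor, Remark 1 after Thm. 6.4)
  obtain ⟨eW, -⟩ := hc.1
  haveI hW : SimplyConnectedSpace c.W := eW.symm.simplyConnectedSpace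
  have hlevb : SimplyConnectedSpace ↥(g ⁻¹' {b}) :=
    (Cobordism.Milnor1965_simplyConnected_levels_holds hc hW hg ⟨hb0, hb1⟩ hreg).1
      fun z hz hlt => ⟨h2 z hz, by have := hidx z hz hlt; omega⟩
  haveI : SimplyConnectedSpace (RegularLevel hb) := hlevb
  let e : V ≃ₜ RegularLevel hb := hι.toHomeomorph.trans (Homeomorph.setCongr hιr)
  haveI : ConnectedSpace V := e.symm.surjective.connectedSpace e.symm.continuous
  exact isEven_intersectionForm_of_homeomorph e
    (hc.isEven_intersectionForm_level hg h2 hb0 hb1 hreg hidx hX₁ hX₂ hb) ν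

end Level

/-! ### The level passage across an index-2 critical point, given the oddness of the twisted surgery -/

section Twist

variable {X₁ X₂ : Type} [TopologicalSpace X₁] [T2Space X₁] [SecondCountableTopology X₁]
  [ChartedSpace (EuclideanSpace ℝ (Fin 4)) X₁] [IsManifold (𝓡 4) ∞ X₁] [CompactSpace X₁] [SimplyConnectedSpace X₁]
  [TopologicalSpace X₂] [T2Space X₂] [SecondCountableTopology X₂]
  [ChartedSpace (EuclideanSpace ℝ (Fin 4)) X₂] [IsManifold (𝓡 4) ∞ X₂] [CompactSpace X₂] [SimplyConnectedSpace X₂]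

/-- **Kirby 1989, Ch. X p. 55 — the level passage across an index-2 critical point is a
connected sum with `S² × S²` when the ends are even, GIVEN that the twisted surgery is odd.**
This is the hypothesis `hstep` of `exists_middleLevel_isStabilization_of_isHCobordism_of_step`
(K1′) for an h-cobordism `c` between simply connected closed smooth 4-manifolds `X₁`, `X₂` with
even intersection forms and a Morse function `g` all of whose critical points have index `≥ 2`
(the situation of a 2/3-handle structure, Milnor Thm. 8.1 both ways), reduced to the one local
statement which this file does not prove (hypothesis `hodd`): *for every simply connected
closed smooth 4-manifold `V` and chart `C`, the surgery along the standard circle of `C` with the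
twisted standard tube, `(C.nbhd.linTwist OpLoop.twist).Surgered` (`≅ V # S² ×~ S²`), has an odd
intersection form for some orientation.*  Indeed by
`Cobordism.IsHCobordism.isConnectedSum_levels_or_twist` the passage is a connected sum with
`S² × S²` or the upper level `V₂` is diffeomorphic to that twisted surgery; the latter is
excluded because `V₂` is even (`Cobordism.IsHCobordism.isEven_intersectionForm_level_of_presentation`)
while the twisted surgery is odd and evenness is a homeomorphism invariant. [cite: Kirby1989, Ch. X, proof of Thm. 1, p. 55] [cite: GompfStipsiczGSM1999, proof of Thm. 9.2.13] -/
theorem Cobordism.IsHCobordism.isConnectedSum_levels_of_isEven_of_isOdd_twist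
    (hodd : ∀ (V : Type) [TopologicalSpace V] [T2Space V] [SecondCountableTopology V] [CompactSpace V]
      [ChartedSpace (EuclideanSpace ℝ (Fin 4)) V] [IsManifold (𝓡 4) ∞ V] [SimplyConnectedSpace V] (C : StdChart V),
      ∃ μ' : HomologicalOrientation ℤ (C.nbhd.linTwist OpLoop.twist).Surgered 4,
        (intersectionForm two_add_two_eq_four μ').IsOdd)
    {c : Cobordism 4 X₁ X₂} (hc : c.IsHCobordism) {g : c.W → ℝ} (hg : c.IsMorseFunction g)
    (h2 : ∀ z ∈ criticalSet (𝓡∂ (4 + 1)) g, 2 ≤ morseIndex (𝓡∂ (4 + 1)) g z)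
    (hX₁ : ∀ μ : HomologicalOrientation ℤ X₁ 4, (intersectionForm two_add_two_eq_four μ).IsEven)
    (hX₂ : ∀ μ : HomologicalOrientation ℤ X₂ 4, (intersectionForm two_add_two_eq_four μ).IsEven)
    {q : c.W} (hq : q ∈ criticalSetOfIndex (𝓡∂ (4 + 1)) g 2)
    {b b₂ : ℝ} (hb : 0 < b) (hbq : b < g q) (hqb₂ : g q < b₂) (hb₂ : b₂ < 1)
    (honly : ∀ z ∈ criticalSet (𝓡∂ (4 + 1)) g, g z ∈ Icc b b₂ → z = q)
    (hidx : ∀ z ∈ criticalSet (𝓡∂ (4 + 1)) g, g z < b → morseIndex (𝓡∂ (4 + 1)) g z = 2)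
    (V : Type) [TopologicalSpace V] [T2Space V] [ChartedSpace (EuclideanSpace ℝ (Fin 4)) V] [IsManifold (𝓡 4) ∞ V]
    (ι : V → c.W) (hι : Manifold.IsSmoothEmbedding (𝓡 4) (𝓡∂ (4 + 1)) ∞ ι) (hιr : range ι = g ⁻¹' {b})
    (V₂ : Type) [TopologicalSpace V₂] [T2Space V₂] [ChartedSpace (EuclideanSpace ℝ (Fin 4)) V₂] [IsManifold (𝓡 4) ∞ V₂]
    (ι₂ : V₂ → c.W) (hι₂ : Manifold.IsSmoothEmbedding (𝓡 4) (𝓡∂ (4 + 1)) ∞ ι₂)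
    (hι₂r : range ι₂ = g ⁻¹' {b₂}) :
    IsConnectedSum (𝓡 4) (𝓡 4) ((𝓡 2).prod (𝓡 2)) V ((Metric.sphere (0 : EuclideanSpace ℝ (Fin 3)) 1) × (Metric.sphere (0 : EuclideanSpace ℝ (Fin 3)) 1)) V₂ := by
  rcases hc.isConnectedSum_levels_or_twist hg hq hb hbq hqb₂ hb₂ honly hidx V ι hι hιr V₂ ι₂ hι₂ hι₂r
    with h | ⟨C, ⟨φ⟩⟩
  · exact h
  exfalso
  have hgc : Continuous g := hg.isMorse.contMDiff.continuous
  -- the two levels are regular; below the upper one all critical points have index `2`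
  have hregb : ∀ z ∈ criticalSet (𝓡∂ (4 + 1)) g, g z ≠ b := fun z hz hzb =>
    absurd (honly z hz ⟨hzb.ge, by rw [hzb]; linarith⟩) fun h => by rw [h] at hzb; linarith
  have hreg₂ : ∀ z ∈ criticalSet (𝓡∂ (4 + 1)) g, g z ≠ b₂ := fun z hz hzb =>
    absurd (honly z hz ⟨by rw [hzb]; linarith, hzb.le⟩) fun h => by rw [h] at hzb; linarith
  have hidx₂ : ∀ z ∈ criticalSet (𝓡∂ (4 + 1)) g, g z < b₂ → morseIndex (𝓡∂ (4 + 1)) g z = 2 := by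
    intro z hz hlt
    by_cases hzb : g z < b
    · exact hidx z hz hzb
    · obtain rfl := honly z hz ⟨not_lt.1 hzb, hlt.le⟩
      exact (mem_criticalSetOfIndex.1 hq).2
  -- the presented levels are compact, second countable and simply connected
  have hclosed : IsClosed (range ι) := by rw [hιr]; exact isClosed_singleton.preimage hgc
  haveI : CompactSpace V :=
    ⟨hι.isEmbedding.isInducing.isCompact_iff.2 (by rw [image_univ]; exact hclosed.isCompact)⟩
  haveI : SecondCountableTopology V := hι.isEmbedding.secondCountableTopology
  have hclosed₂ : IsClosed (range ι₂) := by rw [hι₂r]; exact isClosed_singleton.preimage hgc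
  haveI : CompactSpace V₂ :=
    ⟨hι₂.isEmbedding.isInducing.isCompact_iff.2 (by rw [image_univ]; exact hclosed₂.isCompact)⟩
  haveI : SimplyConnectedSpace V :=
    hc.simplyConnectedSpace_level_of_index_two hg hb (hbq.trans (hqb₂.trans hb₂)) hregb hidx V ι
      hι.isEmbedding hιr
  haveI : SimplyConnectedSpace V₂ :=
    hc.simplyConnectedSpace_level_of_index_two hg (hb.trans (hbq.trans hqb₂)) hb₂ hreg₂ hidx₂ V₂ ι₂
      hι₂.isEmbedding hι₂r
  -- the upper level is even ...
  have heven : ∀ ν : HomologicalOrientation ℤ V₂ 4, (intersectionForm two_add_two_eq_four ν).IsEven :=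
    hc.isEven_intersectionForm_level_of_presentation hg h2 (hb.trans (hbq.trans hqb₂)) hb₂ hreg₂ hidx₂
      hX₁ hX₂ V₂ ι₂ hι₂.isEmbedding hι₂r
  -- ... whereas the twisted surgery, to which it is diffeomorphic, is odd
  obtain ⟨μ', hμ'⟩ := hodd V C
  haveI : ConnectedSpace (C.nbhd.linTwist OpLoop.twist).Surgered :=
    φ.toHomeomorph.surjective.connectedSpace φ.toHomeomorph.continuous
  exact hμ' (isEven_intersectionForm_of_homeomorph φ.toHomeomorph.symm heven μ')

end Twist

end Literature.Topology.FourManifolds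

end
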